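import Summits.BirchSwinnertonDyer.BirchSwinnertonDyer.Theorems.ManinLocalTwoThreeMinimalCubeRootAlgIntRat
import Summits.BirchSwinnertonDyer.BirchSwinnertonDyer.Theorems.ManinLocalTwoThreeKummerCubeSeriesCTransport
import Mathlib.Algebra.QuadraticAlgebra.Basic
import Summits.BirchSwinnertonDyer.BirchSwinnertonDyer.Theorems.ManinLocalTwoThreeCubeSystemThreeAdic
import Summits.BirchSwinnertonDyer.BirchSwinnertonDyer.Theorems.ManinLocalTwoThreeAlgIntCubeRootSeries
import Summits.BirchSwinnertonDyer.BirchSwinnertonDyer.Theorems.ManinLocalTwoThreeMinimalThreeTorsionAlgInt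
import Summits.BirchSwinnertonDyer.BirchSwinnertonDyer.Theorems.EisensteinDepletionAtTwoStarOptBNSFParamIntegral
import HarnessLib

/-!
(RESUBMITTED by p2 g18 for p3 g16 under a new module name: p3's `…MinimalCubeRootAlgIntPrelims` (p737513, PENDING since 18:19Z only because the hub
lacks the olean of the accepted `…CubeRootComponents` p735944) VERBATIM, without that import, plus §X: the two facts of `…CubeRootComponents` that
(INT)_K uses, re-derived in place (lifts `ω ↦ ±Y` inlined; p3's proofs).)
# (INT)_K, preliminaries for the non-rational case: decompositions along `1, Y₁` and `3`-adic bookkeeping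
(route `ManinLocalTwoThree`, crux C3 `ManinPrimeToThreeAtNine` stmt-BirchSwinnertonDyer-22968; cell bsd-f2-manin, prover seat p3 gen 16 —
piece (INT)_K of -an g39's `K`-rational UDC line `UDCKummerLineK`, p2 g18's interface; `--supports` 22968)

Decompositions along `1, Y₁` (`Y₁ = d·Y₀ ∉ ℚ`, `Y₁² = r₁ ∈ ℚ`) of the Kummer series `Θ_T` (`kummerCubeSeriesC_eq_components`), of `g³` for
`g = U + Y₁V` (`cube_add_C_mul`), of `Θ^{min}_T(z_W)` (`thetaMin_eq_components`); `3`-adic bookkeeping: the components `u ± Y₁v` of a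
`3`-adically bounded algebraic integer are `3`-adically bounded (`norm_le_one_components`), and `3ᵉ` clears the rational scalars of `Θ^{min}`
(`exists_isPadicInt_thetaMin`).

HONEST FRAMING.  Algebra only; nothing about C3, Manin's conjecture or BSD is proved here.  No definitions, no sorry. [folklore]
-/

set_option autoImplicit false
-- lint-debt: the directory name repeats the summit name (sibling precedent `ManinLocalTwoThreeMinimalCubeRootAlgIntRat.lean`)
set_option linter.dupNamespace false

noncomputable section

open scoped Classical
open PowerSeries WeierstrassCurve Literature.NumberTheory.EllipticCurves Literature.NumberTheory.EllipticCurves.ModularForms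
open Summit.BirchSwinnertonDyer.Rank1Residual.ManinAdditive.CuspidalKummer
open Summit.BirchSwinnertonDyer.Rank1Residual.ManinAdditive.CuspidalKummerThree
open Summit.BirchSwinnertonDyer.Rank1Residual.ManinAdditive.UDCKummerLine
open Summit.BirchSwinnertonDyer.Rank1Residual.ManinAdditive.UDCKummerLineK

namespace Summit.BirchSwinnertonDyer.BirchSwinnertonDyer.Theorems.ManinLocalTwoThree.MinimalCubeRootC

/-! ## §1 Scalar decompositions along `1, Y₁` -/

/-- `α = κ₀·Y₀` with `κ₀ = (3X₀² + a₄)/(2r) ∈ ℚ`, `r = Y₀²`. [folklore] -/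
theorem tangentSlopeC_eq_ratCast_mul {W : WeierstrassCurve ℚ} {c : ℤ} {X₀ : ℚ} {Y₀ : ℂ} (hT : IsShortThreeTorsionC W c X₀ Y₀)
    {r : ℚ} (hr : (r : ℂ) = Y₀ ^ 2) :
    tangentSlopeC W c X₀ Y₀ = (((3 * X₀ ^ 2 + (shortModel W c).a₄) / (2 * r) : ℚ) : ℂ) * Y₀ := by
  have hY := MinimalThreeTorsionC.y_ne_zero hT
  have hr0 : (r : ℂ) ≠ 0 := by rw [hr]; exact pow_ne_zero 2 hY
  rw [tangentSlopeC]
  push_cast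
  rw [hr]
  field_simp

/-- `C s = C a + C Y₁ · C b` from `s = a + Y₁·b`. [folklore] -/
theorem C_eq_of_eq_add_mul {s Y₁ : ℂ} {a b : ℚ} (h : s = (a : ℂ) + Y₁ * (b : ℂ)) :
    (C s : ℂ⟦X⟧) = C (a : ℂ) + C Y₁ * C (b : ℂ) := by
  rw [h, map_add, map_mul]

/-! ## §2 Series decompositions along `1, Y₁` -/

/-- **`Θ_T = Θ' + Y₁·Θ''`** with `Θ' = (z³y_s)(z)`, `Θ'' = −(1/d)·z³ − (κ₀/d)·((z²x_s)(z)·z − X₀z³)` (`Y₁ = d·Y₀`, `α = κ₀Y₀`). [folklore] -/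
theorem kummerCubeSeriesC_eq_components (W : WeierstrassCurve ℚ) {c : ℤ} (X₀ : ℚ) (Y₀ : ℂ) (z : ℚ⟦X⟧) {κ₀ d : ℚ} (hd : d ≠ 0)
    (hα : tangentSlopeC W c X₀ Y₀ = ((κ₀ : ℚ) : ℂ) * Y₀) :
    kummerCubeSeriesC W c X₀ Y₀ z =
      PowerSeries.map (algebraMap ℚ ℂ) ((shortModel W c).formalYMulCube.subst z)
        + C ((d : ℂ) * Y₀) * PowerSeries.map (algebraMap ℚ ℂ)
            (-(C d⁻¹ * z ^ 3) - C (κ₀ / d) * ((shortModel W c).formalXMulSq.subst z * z - C X₀ * z ^ 3)) := by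
  have hd' : (d : ℂ) ≠ 0 := by exact_mod_cast hd
  have h1 : (C Y₀ : ℂ⟦X⟧) = C ((d : ℂ) * Y₀) * C (((d⁻¹ : ℚ)) : ℂ) := by
    rw [← map_mul]; congr 1; push_cast; field_simp
  have h2 : (C (tangentSlopeC W c X₀ Y₀) : ℂ⟦X⟧) = C ((d : ℂ) * Y₀) * C (((κ₀ / d : ℚ)) : ℂ) := by
    rw [hα, ← map_mul]; congr 1; push_cast; field_simp
  rw [kummerCubeSeriesC_eq, h1, h2]
  simp only [map_sub, map_neg, map_mul, map_pow, PowerSeries.map_C, eq_ratCast]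
  ring

/-- **`g³` along `1, Y₁`**: `(U + Y₁V)³ = (U³ + 3r₁UV²) + Y₁(3U²V + r₁V³)` for `Y₁² = r₁`. [folklore] -/
theorem cube_add_C_mul (U V : ℚ⟦X⟧) {Y₁ : ℂ} {r₁ : ℚ} (hr : Y₁ ^ 2 = (r₁ : ℂ)) :
    (PowerSeries.map (algebraMap ℚ ℂ) U + C Y₁ * PowerSeries.map (algebraMap ℚ ℂ) V) ^ 3 =
      PowerSeries.map (algebraMap ℚ ℂ) (U ^ 3 + 3 * C r₁ * U * V ^ 2)
        + C Y₁ * PowerSeries.map (algebraMap ℚ ℂ) (3 * U ^ 2 * V + C r₁ * V ^ 3) := by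
  have hY2 : (C Y₁ : ℂ⟦X⟧) * C Y₁ = C ((r₁ : ℚ) : ℂ) := by rw [← map_mul, ← sq, hr]
  simp only [map_add, map_mul, map_pow, PowerSeries.map_C, eq_ratCast, map_ofNat]
  linear_combination (3 * PowerSeries.map (algebraMap ℚ ℂ) U * PowerSeries.map (algebraMap ℚ ℂ) V ^ 2
    + C Y₁ * PowerSeries.map (algebraMap ℚ ℂ) V ^ 3) * hY2

/-- **`Θ^{min}_T(z_W)` along `1, Y₁`**: with `y_T = y' + Y₁y''`, `λ = l' + Y₁l''` (rational `y', y'', l', l''`),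
`Y_W − y_T z_W³ − λ(P z_W − x z_W³) = [Y_W − y'z_W³ − l'(P z_W − x z_W³)] + Y₁·[−y''z_W³ − l''(P z_W − x z_W³)]`. [folklore] -/
theorem thetaMin_eq_components (Ym P zW : ℚ⟦X⟧) (x : ℚ) {yT lam Y₁ : ℂ} {y' y'' l' l'' : ℚ}
    (hy : yT = (y' : ℂ) + Y₁ * (y'' : ℂ)) (hl : lam = (l' : ℂ) + Y₁ * (l'' : ℂ)) :
    PowerSeries.map (algebraMap ℚ ℂ) Ym - C yT * PowerSeries.map (algebraMap ℚ ℂ) zW ^ 3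
        - C lam * (PowerSeries.map (algebraMap ℚ ℂ) P * PowerSeries.map (algebraMap ℚ ℂ) zW
            - C ((x : ℚ) : ℂ) * PowerSeries.map (algebraMap ℚ ℂ) zW ^ 3) =
      PowerSeries.map (algebraMap ℚ ℂ) (Ym - C y' * zW ^ 3 - C l' * (P * zW - C x * zW ^ 3))
        + C Y₁ * PowerSeries.map (algebraMap ℚ ℂ) (-(C y'' * zW ^ 3) - C l'' * (P * zW - C x * zW ^ 3)) := by
  rw [C_eq_of_eq_add_mul hy, C_eq_of_eq_add_mul hl]
  simp only [map_sub, map_neg, map_mul, map_pow, PowerSeries.map_C, eq_ratCast]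
  ring

open Summit.BirchSwinnertonDyer.BirchSwinnertonDyer.Theorems.ManinLocalTwoThree.KummerCubeRootBounded
  (exists_norm_pow_mul_le_one norm_pow_mul_le_one_mono)

/-! ## §3 `3`-adic bookkeeping -/

/-- `m = M·q` with `M ∈ ℤ`, `3 ∤ M` ⟹ `‖q‖₃ ≤ 1`. [folklore] -/
theorem norm_le_one_of_int_mul {q : ℚ} {M : ℤ} (hM : ¬ (3 : ℤ) ∣ M) {m : ℤ} (h : (m : ℚ) = M * q) : ‖(q : ℚ_[3])‖ ≤ 1 := by
  have hM1 : ‖((M : ℚ) : ℚ_[3])‖ = 1 := by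
    rw [Rat.cast_intCast]
    exact le_antisymm (Padic.norm_int_le_one _) (not_lt.mp fun hlt ↦ hM (Padic.norm_intCast_lt_one_iff.mp hlt))
  have hM0 : ((M : ℚ) : ℚ_[3]) ≠ 0 := fun h0 ↦ by rw [h0, norm_zero] at hM1; exact zero_ne_one hM1
  have hq : (q : ℚ_[3]) = ((m : ℚ) : ℚ_[3]) / ((M : ℚ) : ℚ_[3]) := by
    rw [eq_div_iff hM0, ← Rat.cast_mul, show q * (M : ℚ) = m by rw [mul_comm]; exact h.symm]
  rw [hq, norm_div, hM1, div_one, Rat.cast_intCast]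
  exact Padic.norm_int_le_one m

/-- **The components `u ± Y₁v` of a `3`-adically bounded algebraic integer are `3`-adically bounded** (`Y₁² = r₁ = 3ᵗr₀`, `3 ∤ r₀`):
from `M3ᴷ(u + Y₁v), M3ᴷ(u − Y₁v) ∈ ℤ̄` (`3 ∤ M`) get `‖3ᴷ⁺ᵗu‖₃, ‖3ᴷ⁺ᵗv‖₃ ≤ 1`. [folklore] -/
theorem norm_le_one_components {Y₁ : ℂ} {r₁ : ℤ} (hY₁ : Y₁ ^ 2 = ((r₁ : ℚ) : ℂ)) {t : ℕ} {r₀ : ℤ} (hfac : r₁ = 3 ^ t * r₀)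
    (hr₀ : ¬ (3 : ℤ) ∣ r₀) {u v : ℚ} {M K : ℕ} (hM : ¬ 3 ∣ M)
    (hp : _root_.IsIntegral ℤ ((M : ℂ) * 3 ^ K * ((u : ℂ) + Y₁ * (v : ℂ))))
    (hm : _root_.IsIntegral ℤ ((M : ℂ) * 3 ^ K * ((u : ℂ) - Y₁ * (v : ℂ)))) :
    ‖(((3 : ℚ) ^ (K + t) * u : ℚ) : ℚ_[3])‖ ≤ 1 ∧ ‖(((3 : ℚ) ^ (K + t) * v : ℚ) : ℚ_[3])‖ ≤ 1 := by
  have hY₁int : _root_.IsIntegral ℤ Y₁ :=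
    MinimalThreeTorsionC.isIntegral_of_monic_quadratic 0 (-r₁) (by push_cast; rw [hY₁]; push_cast; ring)
  -- `u`
  have hu : _root_.IsIntegral ℤ ((((2 * M : ℤ) * (3 ^ K * u) : ℚ)) : ℂ) := by
    have e : ((((2 * M : ℤ) * (3 ^ K * u) : ℚ)) : ℂ) =
        (M : ℂ) * 3 ^ K * ((u : ℂ) + Y₁ * (v : ℂ)) + (M : ℂ) * 3 ^ K * ((u : ℂ) - Y₁ * (v : ℂ)) := by
      push_cast; ring
    rw [e]; exact hp.add hm
  obtain ⟨mu, hmu⟩ := exists_intCast_eq_of_isIntegral hu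
  have h2M : ¬ (3 : ℤ) ∣ 2 * M := by
    intro h3; have : (3 : ℤ) ∣ M := (Int.prime_three.dvd_mul.mp h3).resolve_left (by norm_num)
    exact hM (by exact_mod_cast this)
  have hu1 : ‖(((3 : ℚ) ^ K * u : ℚ) : ℚ_[3])‖ ≤ 1 := norm_le_one_of_int_mul h2M hmu
  -- `v`
  have hv : _root_.IsIntegral ℤ ((((2 * M * r₀ : ℤ) * (3 ^ (K + t) * v) : ℚ)) : ℂ) := by
    have e : ((((2 * M * r₀ : ℤ) * (3 ^ (K + t) * v) : ℚ)) : ℂ) =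
        ((M : ℂ) * 3 ^ K * ((u : ℂ) + Y₁ * (v : ℂ)) - (M : ℂ) * 3 ^ K * ((u : ℂ) - Y₁ * (v : ℂ))) * Y₁ := by
      have e2 : ((M : ℂ) * 3 ^ K * ((u : ℂ) + Y₁ * (v : ℂ)) - (M : ℂ) * 3 ^ K * ((u : ℂ) - Y₁ * (v : ℂ))) * Y₁ =
          2 * M * 3 ^ K * v * Y₁ ^ 2 := by ring
      rw [e2, hY₁, hfac]; push_cast; ring
    rw [e]; exact (hp.sub hm).mul hY₁int
  obtain ⟨mv, hmv⟩ := exists_intCast_eq_of_isIntegral hv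
  have h2Mr : ¬ (3 : ℤ) ∣ 2 * M * r₀ := by
    intro h3
    rcases Int.prime_three.dvd_mul.mp h3 with h3' | h3'
    · exact h2M h3'
    · exact hr₀ h3'
  have hv1 : ‖(((3 : ℚ) ^ (K + t) * v : ℚ) : ℚ_[3])‖ ≤ 1 := norm_le_one_of_int_mul h2Mr hmv
  refine ⟨?_, hv1⟩
  have := norm_pow_mul_le_one_mono (Nat.le_add_right K t) (x := (u : ℚ_[3])) (by push_cast at hu1; exact hu1)
  push_cast
  exact this

/-- A constant series with `‖c‖₃ ≤ 1` is `3`-integral. [folklore] -/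
theorem isPadicInt_C {c : ℚ_[3]} (hc : ‖c‖ ≤ 1) : IsPadicInt (C c : ℚ_[3]⟦X⟧) := by
  rw [isPadicInt_iff_coeff]; intro n
  rw [coeff_C]; split_ifs
  · exact hc
  · simp

/-- Rational constants get `3`-integral after a bounded power of `3`, jointly for three of them. [folklore] -/
theorem exists_pow_norm_le_one₃ (q₁ q₂ q₃ : ℚ) : ∃ e : ℕ, ‖(3 : ℚ_[3]) ^ e * q₁‖ ≤ 1 ∧ ‖(3 : ℚ_[3]) ^ e * q₂‖ ≤ 1 ∧
    ‖(3 : ℚ_[3]) ^ e * q₃‖ ≤ 1 := by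
  obtain ⟨e₁, h₁⟩ := exists_norm_pow_mul_le_one (q₁ : ℚ_[3])
  obtain ⟨e₂, h₂⟩ := exists_norm_pow_mul_le_one (q₂ : ℚ_[3])
  obtain ⟨e₃, h₃⟩ := exists_norm_pow_mul_le_one (q₃ : ℚ_[3])
  exact ⟨e₁ + e₂ + e₃, norm_pow_mul_le_one_mono (by omega) h₁, norm_pow_mul_le_one_mono (by omega) h₂,
    norm_pow_mul_le_one_mono (by omega) h₃⟩

/-- `‖3ᵉ‖₃ ≤ 1`. [folklore] -/
theorem norm_three_pow_le_one (e : ℕ) : ‖((3 : ℚ_[3]) ^ e)‖ ≤ 1 := by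
  rw [norm_pow]
  refine pow_le_one₀ (norm_nonneg _) ?_
  have := Padic.norm_p_lt_one (p := 3)
  exact_mod_cast this.le

/-- **`3`-adic bound for one component of `Θ^{min}`**: with `Y_W, P, z_W` `3`-integral and rational scalars `y, l, x`, some `3ᵉ` clears
`Y_W − y z_W³ − l (P z_W − x z_W³)`. [folklore] -/
theorem exists_isPadicInt_thetaMin (Ym P zW : ℚ⟦X⟧) (hYm : IsPadicInt (PowerSeries.map (algebraMap ℚ ℚ_[3]) Ym))
    (hP : IsPadicInt (PowerSeries.map (algebraMap ℚ ℚ_[3]) P)) (hzW : IsPadicInt (PowerSeries.map (algebraMap ℚ ℚ_[3]) zW))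
    (x y l : ℚ) : ∃ e : ℕ,
      IsPadicInt (PowerSeries.map (algebraMap ℚ ℚ_[3]) (C ((3 : ℚ) ^ e) * (Ym - C y * zW ^ 3 - C l * (P * zW - C x * zW ^ 3)))) := by
  obtain ⟨e, h1, h2, h3⟩ := exists_pow_norm_le_one₃ y l (l * x)
  set ι := PowerSeries.map (algebraMap ℚ ℚ_[3]) with hι
  have hιC : ∀ q : ℚ, ι (C q) = C (q : ℚ_[3]) := fun q ↦ by rw [hι, PowerSeries.map_C, eq_ratCast]
  refine ⟨e, ?_⟩
  have e1 : ι (C ((3 : ℚ) ^ e) * (Ym - C y * zW ^ 3 - C l * (P * zW - C x * zW ^ 3))) =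
      C ((3 : ℚ_[3]) ^ e) * ι Ym - C ((3 : ℚ_[3]) ^ e * y) * ι zW ^ 3 - C ((3 : ℚ_[3]) ^ e * l) * (ι P * ι zW)
        + C ((3 : ℚ_[3]) ^ e * ↑(l * x)) * ι zW ^ 3 := by
    simp only [map_mul, map_sub, map_pow, hιC]; push_cast; simp only [map_mul]; ring
  rw [e1]
  exact ((((isPadicInt_C (norm_three_pow_le_one e)).mul hYm).sub ((isPadicInt_C h1).mul (hzW.pow 3))).sub
    ((isPadicInt_C h2).mul (hP.mul hzW))).add ((isPadicInt_C h3).mul (hzW.pow 3))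

/-- The mono step used for both exponents. [folklore] -/
theorem isPadicInt_C_pow_mul_mono {F : ℚ⟦X⟧} {e e' : ℕ} (hee' : e ≤ e')
    (h : IsPadicInt (PowerSeries.map (algebraMap ℚ ℚ_[3]) (C ((3 : ℚ) ^ e) * F))) :
    IsPadicInt (PowerSeries.map (algebraMap ℚ ℚ_[3]) (C ((3 : ℚ) ^ e') * F)) := by
  obtain ⟨k, rfl⟩ := Nat.exists_eq_add_of_le hee'
  have e1 : PowerSeries.map (algebraMap ℚ ℚ_[3]) (C ((3 : ℚ) ^ (e + k)) * F) =
      C ((3 : ℚ_[3]) ^ k) * PowerSeries.map (algebraMap ℚ ℚ_[3]) (C ((3 : ℚ) ^ e) * F) := by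
    rw [map_mul, map_mul, PowerSeries.map_C, PowerSeries.map_C, pow_add, map_mul, map_pow, map_pow, map_ofNat, map_mul C]; ring
  rw [e1]
  exact (isPadicInt_C (norm_three_pow_le_one k)).mul h

/-! ## §X What (INT)_K needs from `…CubeRootComponents` (p3 g16, p735944), re-derived while the hub lacks that module's olean -/

section Components

open scoped QuadraticAlgebra

/-- `ℚ`-linear independence of `1, Y` read coefficientwise on `map a + C Y · map b`. [folklore] -/
theorem coeff_eq_of_map_add_C_mul_map_eq {Y : ℂ} (hY : ∀ q : ℚ, (q : ℂ) ≠ Y) {a b a' b' : ℚ⟦X⟧}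
    (h : PowerSeries.map (algebraMap ℚ ℂ) a + C Y * PowerSeries.map (algebraMap ℚ ℂ) b =
      PowerSeries.map (algebraMap ℚ ℂ) a' + C Y * PowerSeries.map (algebraMap ℚ ℂ) b') (n : ℕ) :
    coeff n a = coeff n a' ∧ coeff n b = coeff n b' := by
  have hlin : ∀ p q : ℚ, (p : ℂ) + q * Y = 0 → p = 0 ∧ q = 0 := by
    intro p q hpq
    by_cases hq : q = 0
    · subst hq
      simp only [Rat.cast_zero, zero_mul, add_zero, Rat.cast_eq_zero] at hpq
      exact ⟨hpq, rfl⟩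
    · exfalso
      refine hY (-p / q) ?_
      have hq' : (q : ℂ) ≠ 0 := by exact_mod_cast hq
      push_cast
      field_simp
      linear_combination -hpq
  have hn := congrArg (coeff n) h
  simp only [map_add, coeff_map, coeff_C_mul, eq_ratCast] at hn
  have h0 : ((coeff n a - coeff n a' : ℚ) : ℂ) + (coeff n b - coeff n b' : ℚ) * Y = 0 := by
    push_cast; linear_combination hn
  obtain ⟨h1, h2⟩ := hlin _ _ h0
  exact ⟨sub_eq_zero.mp h1, sub_eq_zero.mp h2⟩

/-- **Components of a normalised cube root and integrality of the conjugate** (p3's `CubeRootComponents.exists_components`, first and third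
clauses; the lifts `ω ↦ ±Y` of `ℚ[ω]/(ω² = r)` inlined): `Y ∉ ℚ`, `Y² = r`, `Θ'(0) = −1`, `Θ''(0) = 0`, `h³ = Θ' + Y·Θ''`, `h(0) = −1` ⟹
`h = u + Y·v` with `u, v ∈ ℚ⟦X⟧`, and `m·hₙ ∈ ℤ̄ ⟹ m·(uₙ − Y vₙ) ∈ ℤ̄`. [folklore] -/
theorem exists_components_conj {Y : ℂ} (hY : ∀ q : ℚ, (q : ℂ) ≠ Y) {r : ℚ} (hr : Y ^ 2 = (r : ℂ)) (Θ' Θ'' : ℚ⟦X⟧)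
    (hΘ' : constantCoeff Θ' = -1) (hΘ'' : constantCoeff Θ'' = 0) (h : ℂ⟦X⟧)
    (hh3 : h ^ 3 = PowerSeries.map (algebraMap ℚ ℂ) Θ' + C Y * PowerSeries.map (algebraMap ℚ ℂ) Θ'') (hh0 : constantCoeff h = -1) :
    ∃ u v : ℚ⟦X⟧, h = PowerSeries.map (algebraMap ℚ ℂ) u + C Y * PowerSeries.map (algebraMap ℚ ℂ) v ∧
      ∀ (n : ℕ) (m : ℤ), _root_.IsIntegral ℤ ((m : ℂ) * coeff n h) →
        _root_.IsIntegral ℤ ((m : ℂ) * (((coeff n u : ℚ) : ℂ) - Y * ((coeff n v : ℚ) : ℂ))) := by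
  -- `ℚ`-linear independence of `1, Y`
  have hlin : ∀ p q : ℚ, (p : ℂ) + q * Y = 0 → p = 0 ∧ q = 0 := by
    intro p q hpq
    by_cases hq : q = 0
    · subst hq
      simp only [Rat.cast_zero, zero_mul, add_zero, Rat.cast_eq_zero] at hpq
      exact ⟨hpq, rfl⟩
    · exfalso
      refine hY (-p / q) ?_
      have hq' : (q : ℂ) ≠ 0 := by exact_mod_cast hq
      push_cast
      field_simp
      linear_combination -hpq
  -- the two lifts `ω ↦ ±Y` of `K₀ = ℚ[ω]/(ω² = r)`
  have hcond : ∀ s : ℂ, s = Y ∨ s = -Y → s * s = r • (1 : ℂ) + (0 : ℚ) • s := by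
    intro s hs
    rw [Rat.smul_one_eq_cast, zero_smul, add_zero, ← sq]
    rcases hs with rfl | rfl
    · exact hr
    · rw [neg_sq]; exact hr
  obtain ⟨φp, hφp⟩ : ∃ φp : QuadraticAlgebra ℚ r 0 →ₐ[ℚ] ℂ, φp = QuadraticAlgebra.lift ⟨Y, hcond Y (Or.inl rfl)⟩ := ⟨_, rfl⟩
  obtain ⟨φm, hφm⟩ : ∃ φm : QuadraticAlgebra ℚ r 0 →ₐ[ℚ] ℂ, φm = QuadraticAlgebra.lift ⟨-Y, hcond (-Y) (Or.inr rfl)⟩ := ⟨_, rfl⟩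
  have hφp_apply : ∀ x : QuadraticAlgebra ℚ r 0, φp x = (x.re : ℂ) + (x.im : ℂ) * Y := fun x ↦ by
    rw [hφp, QuadraticAlgebra.lift_apply_apply, Rat.smul_one_eq_cast, Rat.smul_def]
  have hφm_apply : ∀ x : QuadraticAlgebra ℚ r 0, φm x = (x.re : ℂ) + (x.im : ℂ) * (-Y) := fun x ↦ by
    rw [hφm, QuadraticAlgebra.lift_apply_apply, Rat.smul_one_eq_cast, Rat.smul_def]
  have hinj : Function.Injective φp := by
    intro x y hxy
    rw [hφp_apply, hφp_apply] at hxy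
    have h0 : ((x.re - y.re : ℚ) : ℂ) + ((x.im - y.im : ℚ)) * Y = 0 := by push_cast; linear_combination hxy
    obtain ⟨h1, h2⟩ := hlin _ _ h0
    ext
    · exact sub_eq_zero.mp h1
    · exact sub_eq_zero.mp h2
  have hmap_lift : ∀ (ψ : QuadraticAlgebra ℚ r 0 →ₐ[ℚ] ℂ) (s : ℂ), (∀ x, ψ x = (x.re : ℂ) + (x.im : ℂ) * s) →
      ∀ F : (QuadraticAlgebra ℚ r 0)⟦X⟧, PowerSeries.map (ψ : QuadraticAlgebra ℚ r 0 →+* ℂ) F =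
        PowerSeries.map (algebraMap ℚ ℂ) (PowerSeries.mk fun n ↦ (coeff n F).re)
          + C s * PowerSeries.map (algebraMap ℚ ℂ) (PowerSeries.mk fun n ↦ (coeff n F).im) := by
    intro ψ s hψ F
    ext n
    simp only [coeff_map, map_add, coeff_C_mul, coeff_mk, eq_ratCast, RingHom.coe_coe]
    rw [hψ]; ring
  have hmapι : ∀ (ψ : QuadraticAlgebra ℚ r 0 →ₐ[ℚ] ℂ) (G : ℚ⟦X⟧),
      PowerSeries.map (ψ : QuadraticAlgebra ℚ r 0 →+* ℂ) (PowerSeries.map (algebraMap ℚ (QuadraticAlgebra ℚ r 0)) G) =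
        PowerSeries.map (algebraMap ℚ ℂ) G :=
    fun ψ G ↦ by ext n; simp [coeff_map]
  -- the cube root over `K₀` (binomial series, as `CubeRootComponents.exists_cubeRoot_of_constantCoeff_eq_neg_one'`)
  obtain ⟨ΘK, hΘK⟩ : ∃ ΘK : (QuadraticAlgebra ℚ r 0)⟦X⟧, ΘK = PowerSeries.map (algebraMap ℚ (QuadraticAlgebra ℚ r 0)) Θ' +
      C (ω : QuadraticAlgebra ℚ r 0) * PowerSeries.map (algebraMap ℚ (QuadraticAlgebra ℚ r 0)) Θ'' := ⟨_, rfl⟩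
  have hΘK0 : constantCoeff ΘK = -1 := by
    have h1 : coeff 0 Θ' = -1 := by rw [coeff_zero_eq_constantCoeff_apply, hΘ']
    have h2 : coeff 0 Θ'' = 0 := by rw [coeff_zero_eq_constantCoeff_apply, hΘ'']
    rw [← coeff_zero_eq_constantCoeff_apply, hΘK, map_add, coeff_map, h1, coeff_C_mul, coeff_map, h2, map_zero, mul_zero, add_zero,
      map_neg, map_one]
  obtain ⟨hK, hK3, hK0⟩ : ∃ hK : (QuadraticAlgebra ℚ r 0)⟦X⟧, hK ^ 3 = ΘK ∧ constantCoeff hK = -1 := by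
    obtain ⟨Yk, hYk⟩ : ∃ Yk : (QuadraticAlgebra ℚ r 0)⟦X⟧, Yk = -(ΘK + 1) := ⟨_, rfl⟩
    have hY0 : constantCoeff Yk = 0 := by rw [hYk, map_neg, map_add, hΘK0, map_one]; ring
    have hYs : HasSubst Yk := HasSubst.of_constantCoeff_zero' hY0
    have hcube : PowerSeries.binomialSeries (QuadraticAlgebra ℚ r 0) (1 / 3 : ℚ) ^ 3 = 1 + X := by
      have h13 : (1 : ℚ) = 1 / 3 + 1 / 3 + 1 / 3 := by norm_num
      have hb := PowerSeries.binomialSeries_nat (R := ℚ) (A := QuadraticAlgebra ℚ r 0) 1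
      rw [Nat.cast_one, pow_one, h13, PowerSeries.binomialSeries_add, PowerSeries.binomialSeries_add] at hb
      rw [← hb]; ring
    have hg3 : ((PowerSeries.binomialSeries (QuadraticAlgebra ℚ r 0) (1 / 3 : ℚ)).subst Yk) ^ 3 = 1 + Yk := by
      rw [← coe_substAlgHom hYs, ← map_pow, hcube, map_add, map_one, coe_substAlgHom hYs, subst_X hYs]
    have hg0 : constantCoeff ((PowerSeries.binomialSeries (QuadraticAlgebra ℚ r 0) (1 / 3 : ℚ)).subst Yk) = 1 := by
      rw [Literature.RingTheory.FormalGroups.constantCoeff_subst_of_constantCoeff_eq_zero hY0, PowerSeries.binomialSeries_constantCoeff]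
    refine ⟨-(PowerSeries.binomialSeries (QuadraticAlgebra ℚ r 0) (1 / 3 : ℚ)).subst Yk, ?_, ?_⟩
    · rw [neg_pow, hg3, hYk]; ring
    · rw [map_neg, hg0]
  have hφpω : φp ω = Y := by rw [hφp_apply]; simp
  have hΘp : PowerSeries.map (φp : QuadraticAlgebra ℚ r 0 →+* ℂ) ΘK =
      PowerSeries.map (algebraMap ℚ ℂ) Θ' + C Y * PowerSeries.map (algebraMap ℚ ℂ) Θ'' := by
    rw [hΘK, map_add, map_mul, PowerSeries.map_C, hmapι, hmapι, RingHom.coe_coe, hφpω]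
  obtain ⟨u, hu⟩ : ∃ u : ℚ⟦X⟧, u = PowerSeries.mk fun n ↦ (coeff n hK).re := ⟨_, rfl⟩
  obtain ⟨v, hv⟩ : ∃ v : ℚ⟦X⟧, v = PowerSeries.mk fun n ↦ (coeff n hK).im := ⟨_, rfl⟩
  have hpu : PowerSeries.map (φp : QuadraticAlgebra ℚ r 0 →+* ℂ) hK =
      PowerSeries.map (algebraMap ℚ ℂ) u + C Y * PowerSeries.map (algebraMap ℚ ℂ) v := by
    rw [hu, hv]; exact hmap_lift φp Y hφp_apply hK
  -- `h = φp(hK)` by uniqueness of normalised cube roots in `ℂ⟦X⟧`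
  have h3p : (PowerSeries.map (φp : QuadraticAlgebra ℚ r 0 →+* ℂ) hK) ^ 3 = h ^ 3 := by rw [← map_pow, hK3, hΘp, hh3]
  have hK0' : coeff 0 hK = -1 := by rw [coeff_zero_eq_constantCoeff_apply, hK0]
  have h0p : constantCoeff (PowerSeries.map (φp : QuadraticAlgebra ℚ r 0 →+* ℂ) hK) = constantCoeff h := by
    rw [← coeff_zero_eq_constantCoeff_apply, coeff_map, hK0', map_neg, map_one, hh0]
  have heq : PowerSeries.map (φp : QuadraticAlgebra ℚ r 0 →+* ℂ) hK = h :=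
    KummerCubeRootBounded.cubeRoot_unique (by norm_num) h3p h0p (by rw [h0p, hh0]; norm_num)
  refine ⟨u, v, by rw [← hpu, heq], fun n m hint ↦ ?_⟩
  -- integrality passes to the conjugate via `φm ∘ φp⁻¹`
  have hcoef : (m : ℂ) * coeff n h = φp ((m : QuadraticAlgebra ℚ r 0) * coeff n hK) := by
    rw [← heq, coeff_map, map_mul, map_intCast, RingHom.coe_coe]
  rw [hcoef] at hint
  have hint' : _root_.IsIntegral ℤ ((m : QuadraticAlgebra ℚ r 0) * coeff n hK) :=
    (isIntegral_algHom_iff (φp.toRingHom.toIntAlgHom) hinj).mp hint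
  have himg := hint'.map (φm.toRingHom.toIntAlgHom)
  have hφmx : φm (coeff n hK) = ((coeff n u : ℚ) : ℂ) - Y * ((coeff n v : ℚ) : ℂ) := by
    rw [hφm_apply, hu, hv, coeff_mk, coeff_mk]; ring
  have hm : φm (m : QuadraticAlgebra ℚ r 0) = (m : ℂ) := map_intCast φm m
  simpa [hφmx, hm] using himg

end Components

end Summit.BirchSwinnertonDyer.BirchSwinnertonDyer.Theorems.ManinLocalTwoThree.MinimalCubeRootC

end
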